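import Summits.HodgeConjecture.HodgeConjecture.Theorems.F0P3cStCharTSHCDCoordinates           -- ★ (CO) F0P2-p06: `exists_continuousOn_leftInverse`, `skew_fixed`, `skew_recombine`, `skew_coord`, `map_units_inv_eq_neg`
import Summits.HodgeConjecture.HodgeConjecture.Theorems.F0P3cStCharTSHCDescentSemisimpleAlg    -- ★ file A (this seat): `commute_diagonal_iff`
import HarnessLib

/-!
# F0 · P3c · line LH6 «StCharTS» — ROAD «HC-D», brick (D5ii) «SEMISIMPLE DESCENT AT TYPE (a,a,b)», file E₁ (COORDINATES OF THE CENTRALISER SLICE IN NORMAL FORM):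
# `Φ : (Fin 2 → F′) × (Fin 3 → F′) ≃ₜ+ ↥𝔠` for `𝔠 = {Z skew for J′ = diag(ι d) ∣ Z·diag(a,a,b) = diag(a,a,b)·Z}`

Cell `pub/hodgecm-mathlib`, crux H413 = `stmt-HodgeConjecture-24833` (lane `--supports … --as helper`), route HCCMUnconditional; seat F0P3a-p05 (g23), brick (ii-Q) of the split
(D5ii) = (ii-B) normal-form basis (F0P3-p02) + (ii-T) transport (LH6-p02) + (ii-Q) normal-form `𝔠`-integral (this seat) + ★ file D (dealer F0P2-p01 (g23), 16:57:16Z).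
THEOREMS ONLY (no definition ∕ instance ∕ notation ∕ named fact ∕ `sorry`); imports ★ (CO) + ★ file A.  SCALAR-FREE (ruling R3♭ «there is no F»): the fixed field enters only
through the (CO) DOCKING LETTERS `ι : F′ →+* K` (closed embedding, `σ x = x ↔ x ∈ range ι`) and a skew unit `lam` (`σ lam = −lam`).
HONEST LABEL: HC_CM is proved only modulo the 7 printed citations (2 remaining: hLiu418 = `stmt-HodgeConjecture-24832`, h413 = `stmt-HodgeConjecture-24833`)
until rung 0 closes; count-neutral coordinates for the named input (HC-D) «`|D_G|^{−1∕2} ∈ L¹_loc(G)`» [HarishChandra1970, Part VII §1 Thm. 15]; closes no organ.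

THE MATHEMATICS.  In normal form (`J′ = diagonal (ι ∘ d)`, `d i ≠ 0`; `D = diagonal ![a, a, b]`, `a ≠ b`) the centraliser slice `𝔠 = 𝔲(J′) ∩ C(D)` consists of the
block-diagonal skew matrices `Z = [[z₁, x, 0], [−(d₀∕d₁)σx, z₂, 0], [0, 0, z₃]]` with `σ zᵢ = −zᵢ`, `x ∈ K` free (★ file A `commute_diagonal_iff` + the entrywise skew equations
`σ(Z j i)·ι d j + ι d i·Z i j = 0`).  Writing skew scalars as `lam·ι(·)` and `x = ι y₁ + lam·ι y₂` (`σ` an involution fixing exactly `range ι`, `2 ≠ 0`):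
* `exists_coords_centraliser` — **`∃ Φ : (Fin 2 → F′) × (Fin 3 → F′) ≃ₜ+ ↥𝔠`** with ENTRIES `Z₀₀ = lam·ι(y₀ + z₀)`, `Z₀₁ = ι y₁ + lam·ι y₂`, `Z₁₀ = −ι(d₀∕d₁)·(ι y₁ − lam·ι y₂)`,
  `Z₁₁ = lam·ι z₀`, `Z₂₂ = lam·ι z₁`, all other entries `0` (so `Z₀₀ − Z₁₁ = lam·ι y₀`: the `y`-block carries exactly the variables of the discriminant of the `2×2` block, the
  `z`-block the two «dead» directions — the product structure file E₂ Fubinis away); continuity of `Φ⁻¹` from the continuous left inverse of `ι` on its range (★ (CO)).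

## References
* [HarishChandra1970] Harish-Chandra, *Harmonic analysis on reductive p-adic groups*, LNM 162 (1970), Part VI Lemma 22; Part VII §1 Thm. 15.
* [PlatonovRapinchuk1994] V. Platonov, A. Rapinchuk, *Algebraic Groups and Number Theory* (1994), §2.3.3 (unitary Lie algebras over quadratic extensions), §3.3.
* [Rogawski1990] J. D. Rogawski, *Automorphic Representations of Unitary Groups in Three Variables* (1990), §3.6 pp. 28–31 (centralisers of semisimple elements of `U(3)`).
-/

set_option autoImplicit false
-- the mandated namespace has the single-problem summit's repeated segment (`HodgeConjecture.HodgeConjecture`)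
set_option linter.dupNamespace false

open Matrix Topology
open Summit.HodgeConjecture.HodgeConjecture.Cruxes.H413.F0P3cStCharTSHCDCoordinates
open Summit.HodgeConjecture.HodgeConjecture.Cruxes.H413.F0P3cStCharTSHCDescentSemisimpleAlg

namespace Summit.HodgeConjecture.HodgeConjecture.Cruxes.H413.F0P3cStCharTSHCDescentSemisimpleCentreCoords

section Algebra

variable {K : Type*} [Field K] (σ : K →+* K)

/-- **The skew equation for a DIAGONAL form, entrywise**: `(Z.map σ)ᵀ·diag δ + diag δ·Z = 0 ↔ ∀ i j, σ(Z j i)·δ j + δ i·Z i j = 0`. [cite: PlatonovRapinchuk1994, §2.3.3] -/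
theorem skew_diagonal_iff (δ : Fin 3 → K) (Z : Matrix (Fin 3) (Fin 3) K) :
    (Z.map σ)ᵀ * diagonal δ + diagonal δ * Z = 0 ↔ ∀ i j, σ (Z j i) * δ j + δ i * Z i j = 0 := by
  rw [← Matrix.ext_iff]
  refine forall_congr' fun i => forall_congr' fun j => ?_
  simp [Matrix.add_apply, Matrix.mul_diagonal, Matrix.diagonal_mul, Matrix.transpose_apply, Matrix.map_apply]

/-- A `σ`-anti element is `lam` times a `σ`-fixed one: `σ s = −s → σ (s·lam⁻¹) = s·lam⁻¹` (restated from ★ (CO) `skew_fixed`). [cite: PlatonovRapinchuk1994, §2.3.3] -/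
theorem anti_div_fixed (lam : Kˣ) (hlam : σ lam = -lam) {s : K} (h : σ s = -s) : σ (s * ((lam⁻¹ : Kˣ) : K)) = s * ((lam⁻¹ : Kˣ) : K) :=
  skew_fixed σ lam hlam (by rw [h, neg_add_cancel])

/-- The symmetric part `(x + σx)·2⁻¹` is `σ`-fixed (`σ` an involution). [cite: PlatonovRapinchuk1994, §2.3.3] -/
theorem symm_part_fixed (hσ : ∀ x, σ (σ x) = x) (x : K) : σ ((x + σ x) * (2 : K)⁻¹) = (x + σ x) * (2 : K)⁻¹ := by
  rw [map_mul, map_add, hσ, map_inv₀, map_ofNat, add_comm]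

/-- The antisymmetric part divided by `lam`, `(x − σx)·2⁻¹·lam⁻¹`, is `σ`-fixed. [cite: PlatonovRapinchuk1994, §2.3.3] -/
theorem anti_part_fixed (hσ : ∀ x, σ (σ x) = x) (lam : Kˣ) (hlam : σ lam = -lam) (x : K) :
    σ ((x - σ x) * (2 : K)⁻¹ * ((lam⁻¹ : Kˣ) : K)) = (x - σ x) * (2 : K)⁻¹ * ((lam⁻¹ : Kˣ) : K) := by
  rw [map_mul, map_mul, map_sub, hσ, map_inv₀, map_ofNat, map_units_inv_eq_neg σ lam hlam]
  ring

/-- Recombination: `(x + σx)·2⁻¹ + lam·((x − σx)·2⁻¹·lam⁻¹) = x` (`2 ≠ 0`). [cite: PlatonovRapinchuk1994, §2.3.3] -/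
theorem symm_add_anti (h2 : (2 : K) ≠ 0) (lam : Kˣ) (x : K) :
    (x + σ x) * (2 : K)⁻¹ + (lam : K) * ((x - σ x) * (2 : K)⁻¹ * ((lam⁻¹ : Kˣ) : K)) = x := by
  have hl : (lam : K) * ((lam⁻¹ : Kˣ) : K) = 1 := Units.mul_inv lam
  have : (lam : K) * ((x - σ x) * (2 : K)⁻¹ * ((lam⁻¹ : Kˣ) : K)) = (x - σ x) * (2 : K)⁻¹ := by
    calc (lam : K) * ((x - σ x) * (2 : K)⁻¹ * ((lam⁻¹ : Kˣ) : K)) = (x - σ x) * (2 : K)⁻¹ * ((lam : K) * ((lam⁻¹ : Kˣ) : K)) := by ring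
      _ = (x - σ x) * (2 : K)⁻¹ := by rw [hl, mul_one]
  rw [this, ← add_mul, show x + σ x + (x - σ x) = x * 2 by ring, mul_assoc, mul_inv_cancel₀ h2, mul_one]

/-- Recombination: `(x + σx)·2⁻¹ − lam·((x − σx)·2⁻¹·lam⁻¹) = σ x` (`2 ≠ 0`). [cite: PlatonovRapinchuk1994, §2.3.3] -/
theorem symm_sub_anti (h2 : (2 : K) ≠ 0) (lam : Kˣ) (x : K) :
    (x + σ x) * (2 : K)⁻¹ - (lam : K) * ((x - σ x) * (2 : K)⁻¹ * ((lam⁻¹ : Kˣ) : K)) = σ x := by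
  have hl : (lam : K) * ((lam⁻¹ : Kˣ) : K) = 1 := Units.mul_inv lam
  have : (lam : K) * ((x - σ x) * (2 : K)⁻¹ * ((lam⁻¹ : Kˣ) : K)) = (x - σ x) * (2 : K)⁻¹ := by
    calc (lam : K) * ((x - σ x) * (2 : K)⁻¹ * ((lam⁻¹ : Kˣ) : K)) = (x - σ x) * (2 : K)⁻¹ * ((lam : K) * ((lam⁻¹ : Kˣ) : K)) := by ring
      _ = (x - σ x) * (2 : K)⁻¹ := by rw [hl, mul_one]
  rw [this, ← sub_mul, show x + σ x - (x - σ x) = σ x * 2 by ring, mul_assoc, mul_inv_cancel₀ h2, mul_one]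

end Algebra

section Chart

variable {K : Type*} [Field K] [TopologicalSpace K] [IsTopologicalRing K]
  (σ : K →+* K) (hσ : ∀ x, σ (σ x) = x) (hσc : Continuous σ)
  {F' : Type*} [Field F'] [TopologicalSpace F'] [IsTopologicalRing F']
  (ι : F' →+* K) (hι : IsClosedEmbedding ι) (hιr : ∀ x, σ x = x ↔ x ∈ Set.range ι)
  (lam : Kˣ) (hlam : σ lam = -lam)

include hσ hσc hι hιr hlam

/-- **COORDINATES OF THE CENTRALISER SLICE IN NORMAL FORM.**  `σ` a continuous involution of `K` with fixed field `range ι` (`ι : F′ → K` a closed embedding), `lam` a skew unit,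
`2` invertible; `J′ = diagonal (ι ∘ d)` with `d₀, d₁ ≠ 0`, `D = diagonal ![a, a, b]` with `a ≠ b`; `𝔠` the additive subgroup of `J′`-skew matrices commuting with `D` (field hypothesis).
Then `∃ Φ : (Fin 2 → F′) × (Fin 3 → F′) ≃ₜ+ ↥𝔠` with the entries listed in the module docstring. [cite: PlatonovRapinchuk1994, §2.3.3] [cite: Rogawski1990, §3.6 pp. 28–31] -/
theorem exists_coords_centraliser (h2 : (2 : K) ≠ 0) (d : Fin 3 → F') (hd : ∀ i, d i ≠ 0) {a b : K} (hab : a ≠ b)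
    (𝔠 : AddSubgroup (Matrix (Fin 3) (Fin 3) K))
    (h𝔠 : ∀ Z, Z ∈ 𝔠 ↔ (Z.map σ)ᵀ * diagonal (fun i => ι (d i)) + diagonal (fun i => ι (d i)) * Z = 0 ∧
      diagonal ![a, a, b] * Z = Z * diagonal ![a, a, b]) :
    ∃ Φ : ((Fin 2 → F') × (Fin 3 → F')) ≃ₜ+ ↥𝔠, ∀ p : (Fin 2 → F') × (Fin 3 → F'),
      ((Φ p : ↥𝔠) : Matrix (Fin 3) (Fin 3) K) 0 0 = lam * ι (p.2 0 + p.1 0) ∧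
      ((Φ p : ↥𝔠) : Matrix (Fin 3) (Fin 3) K) 0 1 = ι (p.2 1) + lam * ι (p.2 2) ∧
      ((Φ p : ↥𝔠) : Matrix (Fin 3) (Fin 3) K) 1 0 = -(ι (d 0 / d 1) * (ι (p.2 1) - lam * ι (p.2 2))) ∧
      ((Φ p : ↥𝔠) : Matrix (Fin 3) (Fin 3) K) 1 1 = lam * ι (p.1 0) ∧
      ((Φ p : ↥𝔠) : Matrix (Fin 3) (Fin 3) K) 2 2 = lam * ι (p.1 1) ∧
      ((Φ p : ↥𝔠) : Matrix (Fin 3) (Fin 3) K) 0 2 = 0 ∧ ((Φ p : ↥𝔠) : Matrix (Fin 3) (Fin 3) K) 1 2 = 0 ∧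
      ((Φ p : ↥𝔠) : Matrix (Fin 3) (Fin 3) K) 2 0 = 0 ∧ ((Φ p : ↥𝔠) : Matrix (Fin 3) (Fin 3) K) 2 1 = 0 := by
  obtain ⟨g, hg, hgc⟩ := exists_continuousOn_leftInverse ι hι
  have hισ : ∀ x, σ (ι x) = ι x := fun x => (hιr _).2 ⟨x, rfl⟩
  have hfix : ∀ x : K, σ x = x → ι (g x) = x := fun x hx => by
    obtain ⟨y, rfl⟩ := (hιr x).1 hx; rw [hg]
  have hιc : Continuous ι := hι.continuous
  have hab' : ∀ x : K, (a - b) * x = 0 → x = 0 := fun x hx =>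
    (mul_eq_zero.1 hx).resolve_left (sub_ne_zero.2 hab)
  have hιd : ∀ i, ι (d i) ≠ 0 := fun i => (map_ne_zero ι).2 (hd i)
  have hq : ι (d 0 / d 1) * ι (d 1) = ι (d 0) := by rw [map_div₀, div_mul_cancel₀ _ (hιd 1)]
  have hq' : ι (d 0 * (d 1)⁻¹) * ι (d 1) = ι (d 0) := by rw [← div_eq_mul_inv]; exact hq
  -- the forward matrix
  set M : (Fin 2 → F') × (Fin 3 → F') → Matrix (Fin 3) (Fin 3) K := fun p =>
    !![lam * ι (p.2 0 + p.1 0), ι (p.2 1) + lam * ι (p.2 2), 0;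
       -(ι (d 0 / d 1) * (ι (p.2 1) - lam * ι (p.2 2))), lam * ι (p.1 0), 0;
       0, 0, lam * ι (p.1 1)] with hM
  have hMmem : ∀ p, M p ∈ 𝔠 := fun p => by
    rw [h𝔠, skew_diagonal_iff, commute_diagonal_iff hab']
    refine ⟨fun i j => ?_, ⟨rfl, rfl, rfl, rfl⟩⟩
    fin_cases i <;> fin_cases j <;>
      simp only [hM, Matrix.of_apply, Matrix.cons_val', Matrix.cons_val_zero, Matrix.cons_val_one, Matrix.cons_val_two, Matrix.head_cons,
        Matrix.tail_cons, Matrix.empty_val', Matrix.cons_val_fin_one, Matrix.head_fin_const, Fin.isValue, Fin.mk_zero, Fin.mk_one, Fin.reduceFinMk,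
        map_add, map_sub, map_neg, map_mul, map_zero, hισ, hlam] <;>
      first
        | ring1
        | linear_combination (-(ι (p.2 1)) - (lam : K) * ι (p.2 2)) * hq'
        | linear_combination (-(ι (p.2 1)) + (lam : K) * ι (p.2 2)) * hq'
        | linear_combination (ι (p.2 1) - (lam : K) * ι (p.2 2)) * hq'
        | linear_combination (ι (p.2 1) + (lam : K) * ι (p.2 2)) * hq'
        | linear_combination (-(ι (p.2 1)) - (lam : K) * ι (p.2 2)) * hq
        | linear_combination (-(ι (p.2 1)) + (lam : K) * ι (p.2 2)) * hq
  -- the backward coordinates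
  set N : Matrix (Fin 3) (Fin 3) K → (Fin 2 → F') × (Fin 3 → F') := fun Z =>
    (![g (Z 1 1 * ((lam⁻¹ : Kˣ) : K)), g (Z 2 2 * ((lam⁻¹ : Kˣ) : K))],
     ![g ((Z 0 0 - Z 1 1) * ((lam⁻¹ : Kˣ) : K)), g ((Z 0 1 + σ (Z 0 1)) * (2 : K)⁻¹), g ((Z 0 1 - σ (Z 0 1)) * (2 : K)⁻¹ * ((lam⁻¹ : Kˣ) : K))]) with hN
  -- left inverse
  have hNM : ∀ p, N (M p) = p := fun p => by
    obtain ⟨z, y⟩ := p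
    simp only [hN, hM, Matrix.of_apply, Matrix.cons_val', Matrix.cons_val_zero, Matrix.cons_val_one, Matrix.cons_val_two, Matrix.head_cons,
      Matrix.tail_cons, Matrix.empty_val', Matrix.cons_val_fin_one, Matrix.head_fin_const, map_add, map_mul, hισ, hlam, Prod.mk.injEq]
    constructor
    · funext k
      fin_cases k <;>
        simp only [Fin.isValue, Fin.mk_zero, Fin.mk_one, Matrix.cons_val_zero, Matrix.cons_val_one, Matrix.cons_val_fin_one, skew_coord, hg]
    · funext k
      fin_cases k <;>
        simp only [Fin.isValue, Fin.mk_zero, Fin.mk_one, Fin.reduceFinMk, Matrix.cons_val_zero, Matrix.cons_val_one, Matrix.cons_val_two, Matrix.head_cons,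
          Matrix.tail_cons]
      · rw [show ((lam : K) * (ι (y 0) + ι (z 0)) - (lam : K) * ι (z 0)) * ((lam⁻¹ : Kˣ) : K) = (lam : K) * ι (y 0) * ((lam⁻¹ : Kˣ) : K) by ring,
          skew_coord, hg]
      · rw [show (ι (y 1) + (lam : K) * ι (y 2) + (ι (y 1) + -(lam : K) * ι (y 2))) * (2 : K)⁻¹ = ι (y 1) by
          rw [show ι (y 1) + (lam : K) * ι (y 2) + (ι (y 1) + -(lam : K) * ι (y 2)) = ι (y 1) * 2 by ring, mul_assoc, mul_inv_cancel₀ h2, mul_one], hg]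
      · rw [show (ι (y 1) + (lam : K) * ι (y 2) - (ι (y 1) + -(lam : K) * ι (y 2))) * (2 : K)⁻¹ * ((lam⁻¹ : Kˣ) : K) =
            (lam : K) * ι (y 2) * ((lam⁻¹ : Kˣ) : K) by
          rw [show ι (y 1) + (lam : K) * ι (y 2) - (ι (y 1) + -(lam : K) * ι (y 2)) = (lam : K) * ι (y 2) * 2 by ring, mul_assoc _ (2 : K),
            mul_inv_cancel₀ h2, mul_one], skew_coord, hg]
  -- right inverse on `𝔠`
  have hMN : ∀ Z ∈ 𝔠, M (N Z) = Z := fun Z hZ => by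
    rw [h𝔠, skew_diagonal_iff, commute_diagonal_iff hab'] at hZ
    obtain ⟨hsk, h02, h12, h20, h21⟩ := hZ
    have ediag : ∀ i, σ (Z i i) = -Z i i := fun i => by
      have h := hsk i i
      exact (mul_left_injective₀ (hιd i)) (by simp only [neg_mul]; linear_combination h)
    have e10 : Z 1 0 = -(ι (d 0 / d 1) * σ (Z 0 1)) := by
      have h := hsk 1 0
      have hd1K : ι (d 1) ≠ 0 := hιd 1
      rw [map_div₀]
      field_simp
      linear_combination h
    have f00 := hfix _ (anti_div_fixed σ lam hlam (show σ (Z 0 0 - Z 1 1) = -(Z 0 0 - Z 1 1) by rw [map_sub, ediag, ediag]; ring))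
    have f11 := hfix _ (anti_div_fixed σ lam hlam (ediag 1))
    have f22 := hfix _ (anti_div_fixed σ lam hlam (ediag 2))
    have f01s := hfix _ (symm_part_fixed σ hσ (Z 0 1))
    have f01a := hfix _ (anti_part_fixed σ hσ lam hlam (Z 0 1))
    ext i j
    fin_cases i <;> fin_cases j <;>
      simp only [hM, hN, Matrix.of_apply, Matrix.cons_val', Matrix.cons_val_zero, Matrix.cons_val_one, Matrix.cons_val_two, Matrix.head_cons,
        Matrix.tail_cons, Matrix.empty_val', Matrix.cons_val_fin_one, Matrix.head_fin_const, Fin.isValue, Fin.mk_zero, Fin.mk_one, Fin.reduceFinMk,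
        map_add, f00, f11, f22, f01s, f01a]
    · rw [show (Z 0 0 - Z 1 1) * ((lam⁻¹ : Kˣ) : K) + Z 1 1 * ((lam⁻¹ : Kˣ) : K) = Z 0 0 * ((lam⁻¹ : Kˣ) : K) by ring, skew_recombine]
    · exact symm_add_anti σ h2 lam (Z 0 1)
    · exact h02.symm
    · rw [symm_sub_anti σ h2 lam (Z 0 1), e10]
    · exact skew_recombine lam _
    · exact h12.symm
    · exact h20.symm
    · exact h21.symm
    · exact skew_recombine lam _
  -- continuity
  have hMc : Continuous M := by
    refine continuous_matrix fun i j => ?_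
    fin_cases i <;> fin_cases j <;>
      simp only [hM, Matrix.of_apply, Matrix.cons_val', Matrix.cons_val_zero, Matrix.cons_val_one, Matrix.cons_val_two, Matrix.head_cons,
        Matrix.tail_cons, Matrix.empty_val', Matrix.cons_val_fin_one, Matrix.head_fin_const, Fin.isValue, Fin.mk_zero, Fin.mk_one, Fin.reduceFinMk] <;>
      fun_prop
  have hNc : Continuous fun X : ↥𝔠 => N (X : Matrix (Fin 3) (Fin 3) K) := by
    have hent : ∀ i j, Continuous fun X : ↥𝔠 => (X : Matrix (Fin 3) (Fin 3) K) i j :=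
      fun i j => (continuous_apply j).comp ((continuous_apply i).comp continuous_subtype_val)
    have hmem : ∀ X : ↥𝔠, (∀ i j, σ ((X : Matrix (Fin 3) (Fin 3) K) j i) * ι (d j) + ι (d i) * (X : Matrix (Fin 3) (Fin 3) K) i j = 0) :=
      fun X => (skew_diagonal_iff σ _ _).1 ((h𝔠 _).1 X.2).1
    have ediag : ∀ (X : ↥𝔠) (i : Fin 3), σ ((X : Matrix (Fin 3) (Fin 3) K) i i) = -(X : Matrix (Fin 3) (Fin 3) K) i i := fun X i => by
      have h := hmem X i i
      exact (mul_left_injective₀ (hιd i)) (by simp only [neg_mul]; linear_combination h)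
    refine Continuous.prodMk (continuous_pi fun k => ?_) (continuous_pi fun k => ?_)
    · fin_cases k <;> simp only [Fin.isValue, Fin.mk_zero, Fin.mk_one, Matrix.cons_val_zero, Matrix.cons_val_one, Matrix.cons_val_fin_one]
      · exact hgc.comp_continuous ((hent 1 1).mul continuous_const) fun X => (hιr _).1 (anti_div_fixed σ lam hlam (ediag X 1))
      · exact hgc.comp_continuous ((hent 2 2).mul continuous_const) fun X => (hιr _).1 (anti_div_fixed σ lam hlam (ediag X 2))
    · fin_cases k <;> simp only [Fin.isValue, Fin.mk_zero, Fin.mk_one, Fin.reduceFinMk, Matrix.cons_val_zero, Matrix.cons_val_one, Matrix.cons_val_two,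
        Matrix.head_cons, Matrix.tail_cons]
      · exact hgc.comp_continuous (((hent 0 0).sub (hent 1 1)).mul continuous_const) fun X =>
          (hιr _).1 (anti_div_fixed σ lam hlam (show σ ((X : Matrix (Fin 3) (Fin 3) K) 0 0 - (X : Matrix (Fin 3) (Fin 3) K) 1 1) = _ by
            rw [map_sub, ediag, ediag]; ring))
      · exact hgc.comp_continuous (((hent 0 1).add (hσc.comp (hent 0 1))).mul continuous_const) fun X =>
          (hιr _).1 (symm_part_fixed σ hσ _)
      · exact hgc.comp_continuous ((((hent 0 1).sub (hσc.comp (hent 0 1))).mul continuous_const).mul continuous_const) fun X =>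
          (hιr _).1 (anti_part_fixed σ hσ lam hlam _)
  -- additivity
  have hMadd : ∀ p q, M (p + q) = M p + M q := fun p q => by
    ext i j
    fin_cases i <;> fin_cases j <;>
      simp only [hM, Matrix.add_apply, Prod.fst_add, Prod.snd_add, Pi.add_apply, Matrix.of_apply, Matrix.cons_val', Matrix.cons_val_zero, Matrix.cons_val_one,
        Matrix.cons_val_two, Matrix.head_cons, Matrix.tail_cons, Matrix.empty_val', Matrix.cons_val_fin_one, Matrix.head_fin_const, Fin.isValue, Fin.mk_zero,
        Fin.mk_one, Fin.reduceFinMk, map_add] <;> ring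
  -- assemble
  let Φ : ((Fin 2 → F') × (Fin 3 → F')) ≃ₜ+ ↥𝔠 :=
    { toFun := fun p => ⟨M p, hMmem p⟩
      invFun := fun X => N (X : Matrix (Fin 3) (Fin 3) K)
      left_inv := fun p => hNM p
      right_inv := fun X => Subtype.ext (hMN X.1 X.2)
      map_add' := fun p q => Subtype.ext (hMadd p q)
      continuous_toFun := hMc.subtype_mk _
      continuous_invFun := hNc }
  have hΦ : ∀ p, ((Φ p : ↥𝔠) : Matrix (Fin 3) (Fin 3) K) = M p := fun p => rfl
  refine ⟨Φ, fun p => ?_⟩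
  simp only [hΦ, hM, Matrix.of_apply, Matrix.cons_val', Matrix.cons_val_zero, Matrix.cons_val_one, Matrix.cons_val_two, Matrix.head_cons,
    Matrix.tail_cons, Matrix.empty_val', Matrix.cons_val_fin_one, Matrix.head_fin_const, and_self]

end Chart

end Summit.HodgeConjecture.HodgeConjecture.Cruxes.H413.F0P3cStCharTSHCDescentSemisimpleCentreCoords
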